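import Mathlib
import Summits.QuantumFields.YangMills.Theorems.BalabanUVNodesN15FirstOrderPerturbation
import HarnessLib

/-!
# Route «BalabanUVNodes» (cluster K4 «SpineRates»), Track-A DAG node N15 = spine estimate NE2, BACKGROUND LAYER — FIRST MISSING
# ESTIMATE, part 19: `V′₁(A)` OF (3.52), ONE DIRECTION, IN COORDINATES — part 17's three-term sandwich with EVERY COEFFICIENT LETTER DISCHARGED from
# the FIELD letters of the `𝔤`-valued background (`‖A‖ ≤ r`, blockwise fit `o`, bond letter `G`, the divergence fit `o₂`) and the basis constant `κ_e`
# of part 16; what remains are the factor entries (`T′`, its own (3.42)₃ entry, `A`, `∇A`, `pull s∘A`), the shift kernel's row norm, geometry and weight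

Cell `pub-ymgap`, seat `pub-ymgap-dag-n15-b` (generation g3; FIRST-MISSING-ESTIMATE, HUMAN RULING D-0062; chair R424 venue; ROSTER-D0062
l.26).  `bears_on: R4∕N15`.  Filed `--supports stmt-QuantumFields-19351`.  Executes the referee's optional note on part 16 (ref-B g7 READ-322, INBOX
2026-08-26T10:12Z): *«part 14's full first-order sandwich IN COORDINATES is one more by-name instantiation away (`c′ := coordMat e ∘ Phi1 …`, `α ↦ κ_eα`,
`o ↦ κ_e(2e·o + 2e(2r)²η)`) — state it when the OperatorReadout assembly consumes it»* — stated here for all three terms of (3.52) at once, so that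
the -a side's `OperatorReadout` assembly can consume the background block with field letters only.

WHY.  [Balaban1985BackgroundPropagators] (3.52) p. 400 (verbatim, first-hand): *«V′₁(A)λ(x) = Σ_{b∈st(x)} i[A′(b), (D^η_U λ)(b)] + i[(D^{η*}_U A)(x),
λ(x)] + Σ_{b∈st(x)} F′_{1,k}(i ad_{A′(b)}) λ(b₊)»*; the background enters through (3.35) p. 396 (*«|A(b)| ≤ O(1)Mα₀(L^jη)^{−1}, |∇A| ≤ …»* — SHAPES `r`, `G`)
and the coefficients are `ad_{A(b)}`, `ad_{(D*A)(x)}`, `F′_{1,k}(ad_{A(b)})`.  In coordinates `e : 𝔄 ≃L[ℝ] ℝ^ι` (part 16) their max-row-sum letters are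
`κ_e·2r` (size), `κ_e·2G` (bond difference), `κ_e·2·o` (fit) for `ad`, and `κ_e·e(2r)(2r)` ∕ `κ_e(2e(2r)·o + 2e(2r)³η)` for `F′_{1,k}(ad)` (part 17 §3) —
here they are plugged into part 17's `hasMaj_comp_idef_V1dir_comp`, including the composite (3.42)₃ entry of `T′∘M_{ad A′}` (part 14's
`hasMaj_comp_mmulOp_bdiffN` with the shift majorant `hasMaj_pull_liftEquiv_symm`).  THE PRINT USED (SHAPES only): (3.35)∕(3.36) p. 396, (3.42) p. 397,
(3.52) p. 400; [B6] (2.54)∕(2.60) pp. 233–234.  Nothing of [B9] asserted.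

CONTENTS (all [folklore]; parts 14∕16∕17, `B9SectDWeightedNeumann.wrow_conv`, `ShiftSpecies.wrow_const_mul` BY NAME).
* §1 `wrow_add` (row norms add), `wrow_conv_one` (`κ = 1` convolution).
* §2 `hasMaj_adCoeff_bdiffN_coords` — THE COMPOSITE (3.42)₃ ENTRY OF `T′∘M_{ad A′}` IN COORDINATES from `T′`'s OWN entry `N₃⁰` (`‖N₃⁰‖_ρ ≤ m₃⁰`), `T′ ≤ N_T`,
  the shift kernel (`‖K_sh‖_ρ ≤ m_sh`) and the field letters `r`, `G`: majorant `κ_e2r·N₃⁰ + κ_e2G·(N_T ⋆ K_sh)`, row norm `κ_e2r·m₃⁰ + κ_e2G·m_T·m_sh`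
  (`wrow_adCoeff_bdiffN_coords`).
* §3 **`hasMaj_comp_idef_V1dir_comp_coords`** — part 17's one-direction `V′₁` sandwich with `C₁ = coordMat(ad A)`, `C₂ = coordMat(ad V)` (`V` = the
  divergence field, its fit `o₂` a letter of 12b's species S2), `C₃ = coordMat(F′_{1,k}(ad A))`: conclusion `(K₁ + K₂ + K₃)·e^{−ρd}·w(y′)` with
  `K₁ = (κ_e2r·m₃⁰ + κ_e2G·m_T·m_sh)A₁c′_η + m_Tε₁A₁C`, `K₂ = m_Tε₂A₀C`, `K₃ = κ_ee(2r)(2r)·m_TA₁c_η + m_Tε₃A_sC`; REMAINING BINDERS: geometry∕weight,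
  `T′ ≤ N_T`, `T′∘∇′* ≤ N₃⁰`, `A`∕`∇A`∕`pull s∘A` majorants, `‖K_sh‖_ρ ≤ m_sh`, the dominations `κ_e·(fit) ≤ ε_k·w`, `|η′|(M−1) ≤ c′_ηw`, `|η| ≤ c_ηw`.

HONEST FRAMING ∕ LIMITS.  By-name instantiation only; the divergence field `V ↔ D*A` and its fit are letters (12b's S2 supplies `o₂` on `ℤ^d`∕King's
torus componentwise); `U ≡ 1` derivative in T1 (the transported version is part 18's `hasMaj_comp_idef_coeffCovD_comp`, same plumbing).  NE2⁺ NOT PRINTED,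
NOT proved; count-neutral (typed 28∕28; nothing discharged); one finite T⁴ at fixed ε — NOT infinite volume, NOT OS on ℝ⁴, NOT a mass gap, NOT Clay.
-/

noncomputable section

namespace Summit.QuantumFields.YangMills.BalabanUVNodes.N15.MatrixSpecies

open Literature.MathematicalPhysics.QuantumFieldTheory.Balaban1983to89
open Literature.MathematicalPhysics.QuantumFieldTheory.Balaban1983to89.T4EtaRateDefect (idef SlowWeight)
open Literature.MathematicalPhysics.QuantumFieldTheory.Balaban1983to89.T4EtaRateCoeffDefect (pull)
open Literature.MathematicalPhysics.QuantumFieldTheory.Balaban1983to89.Beta.AveragingCorrectionJets (adCLM)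
open B6RandomWalk B11SectG B9SectDWeightedNeumann Finset
open Summit.QuantumFields.YangMills.BalabanUVNodes.N15.DerivDefect
open Summit.QuantumFields.YangMills.BalabanUVNodes.N15.ShiftSpecies (wrow_const_mul)

/-! ## §1 Row-norm algebra -/

section WRowAlgebra

variable {g : B6.Geometry}

/-- Weighted row norms ADD: `‖N₁‖_ρ ≤ m₁`, `‖N₂‖_ρ ≤ m₂` ⟹ `‖N₁ + N₂‖_ρ ≤ m₁ + m₂`. [folklore] -/
theorem wrow_add {ρ m₁ m₂ : ℝ} {N₁ N₂ : g.Site → g.Site → ℝ} (h₁ : WRow g ρ N₁ m₁) (h₂ : WRow g ρ N₂ m₂) :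
    WRow g ρ (fun y y' => N₁ y y' + N₂ y y') (m₁ + m₂) := fun y => by
  have := add_le_add (h₁ y) (h₂ y)
  rw [← Finset.sum_add_distrib] at this
  refine le_trans (le_of_eq (Finset.sum_congr rfl fun y' _ => ?_)) this
  ring

/-- `κ = 1` convolution (`B9SectDWeightedNeumann.wrow_conv`): `‖N₁ ⋆ N₂‖_ρ ≤ m₁m₂`. [cite: Balaban1984PropagatorsII, (2.54) p.233] -/
theorem wrow_conv_one {ρ m₁ m₂ : ℝ} {N₁ N₂ : g.Site → g.Site → ℝ} (htri : Triangle254 g) (hρ : 0 ≤ ρ) (hN₁ : ∀ x y, 0 ≤ N₁ x y)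
    (hN₂ : ∀ x y, 0 ≤ N₂ x y) (hm₂ : 0 ≤ m₂) (h₁ : WRow g ρ N₁ m₁) (h₂ : WRow g ρ N₂ m₂) :
    WRow g ρ (fun y y' => ∑ y'', N₁ y y'' * N₂ y'' y') (m₁ * m₂) := by
  have key := wrow_conv (κ := 1) htri hρ zero_le_one hN₁ hN₂ hm₂ h₁ h₂
  simp only [one_mul] at key
  exact key

/-- The weighted row norm of §2's composite entry: `κ2r·m₃⁰ + κ2G·(m_T·m_sh)` from `‖N₃⁰‖_ρ ≤ m₃⁰`, `‖N_T‖_ρ ≤ m_T`, `‖K_sh‖_ρ ≤ m_sh`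
(`wrow_add`, `wrow_const_mul`, `wrow_conv_one`; `K_sh` = the product shift kernel of part 14). [folklore] -/
theorem wrow_adCoeff_bdiffN_coords {X X' : Type} [Fintype X] (D : LineData X X') (ι : Type) [Fintype ι] (blk : X → g.Site)
    {κ r G ρ m₃ m_T msh : ℝ} (htri : Triangle254 g) (hρ : 0 ≤ ρ) (hκ : 0 ≤ κ) (hr : 0 ≤ r) (hG : 0 ≤ G)
    (hmsh : 0 ≤ msh) {N₃ N_T : g.Site → g.Site → ℝ} (hNT : ∀ y y', 0 ≤ N_T y y')
    (hm₃ : WRow g ρ N₃ m₃) (hmT : WRow g ρ N_T m_T) (hsh : WRow g ρ (shiftKernel (prodLine D ι) (liftBlk blk ι)) msh) :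
    WRow g ρ (fun y y' => (κ * (2 * r)) * N₃ y y' + (κ * (2 * G)) * ∑ y'', N_T y y'' * shiftKernel (prodLine D ι) (liftBlk blk ι) y'' y')
      ((κ * (2 * r)) * m₃ + (κ * (2 * G)) * (m_T * msh)) :=
  wrow_add (wrow_const_mul (by positivity) hm₃)
    (wrow_const_mul (by positivity) (wrow_conv_one htri hρ hNT (shiftKernel_nonneg _ _) hmsh hmT hsh))

end WRowAlgebra

/-! ## §2 The composite (3.42)₃ entry of `T′ ∘ M_{ad A′}` in coordinates -/

section AdEntry

variable {ι : Type} [Fintype ι] [DecidableEq ι] {𝔄 : Type} [NormedRing 𝔄] [NormedAlgebra ℝ 𝔄] (e : 𝔄 ≃L[ℝ] (ι → ℝ))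
variable {X X' : Type} [Fintype X] [Fintype X'] (D : LineData X X') {g : B6.Geometry} (blk : X → g.Site)
variable {F₃ : Type} [AddCommGroup F₃] [Module ℝ F₃] {b₃ : BlockNorm g F₃}

/-- **THE COMPOSITE ADJOINT-DERIVATIVE ENTRY OF `T′ ∘ M_{ad A′}` IN COORDINATES** (binder `hS` of parts 14∕17): from `T′`'s OWN (3.42)₃ entry `T′∘∇′*_{η′} ≤ N₃⁰`
(`N₃⁰ ≥ 0`), `T′ ≤ N_T` (`≥ 0`), and the FIELD letters `‖A′(x′)‖ ≤ r`, `‖A′(x′) − A′(s′⁻¹x′)‖ ≤ η′G` (`η′ > 0`, `G ≥ 0`): `(T′∘M_{coordMat(ad A′)})∘∇′*_{η′} ≤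
κ_e2r·N₃⁰ + κ_e2G·(N_T ⋆ K_sh)`, `K_sh` = the product shift kernel (14's `hasMaj_comp_mmulOp_bdiffN` + `hasMaj_pull_liftEquiv_symm` + 17's `rowBound_ad`∕`rowDiff_ad`).
[cite: Balaban1985BackgroundPropagators, Thm 3.1 (3.42) p.397 + (3.35) p.396 (shapes)] -/
theorem hasMaj_adCoeff_bdiffN_coords {T' : (X' × ι → ℝ) →ₗ[ℝ] F₃} {η' r G : ℝ} (hη' : 0 < η') (hr : 0 ≤ r) (hG : 0 ≤ G)
    {a' : X' → 𝔄} (ha' : ∀ x', ‖a' x'‖ ≤ r) (hda' : ∀ x', ‖a' x' - a' (D.s'.symm x')‖ ≤ η' * G)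
    {N₃ N_T : g.Site → g.Site → ℝ} (hN₃ : ∀ y y', 0 ≤ N₃ y y') (hNT : ∀ y y', 0 ≤ N_T y y')
    (hS₀ : HasMaj (BlockNorm.ofBlocks g (liftBlk (blk ∘ D.π) ι)) b₃ (T' ∘ₗ bdiffN η' (prodLine D ι).s') N₃)
    (hT : HasMaj (BlockNorm.ofBlocks g (liftBlk (blk ∘ D.π) ι)) b₃ T' N_T) :
    HasMaj (BlockNorm.ofBlocks g (liftBlk (blk ∘ D.π) ι)) b₃
      ((T' ∘ₗ mmulOp fun x' => coordMat e (adCLM ℝ (a' x'))) ∘ₗ bdiffN η' (prodLine D ι).s')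
      (fun y y' => (basisConst e * (2 * r)) * N₃ y y' +
        (basisConst e * (2 * G)) * ∑ y'', N_T y y'' * shiftKernel (prodLine D ι) (liftBlk blk ι) y'' y') :=
  hasMaj_comp_mmulOp_bdiffN (g := g) (blk ∘ D.π) hN₃ hNT (mul_nonneg (basisConst_nonneg e) (by positivity))
    (mul_nonneg (basisConst_nonneg e) (by positivity)) hS₀ hT (hasMaj_pull_liftEquiv_symm D ι blk)
    (rowBound_ad e ha') (rowDiff_ad e D.s' hη' hda')

end AdEntry

/-! ## §3 One direction of `V′₁(A)` in coordinates, coefficient letters discharged -/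

section V1Coords

variable {ι : Type} [Fintype ι] [DecidableEq ι] {𝔄 : Type} [NormedRing 𝔄] [NormedAlgebra ℝ 𝔄] [CompleteSpace 𝔄] (e : 𝔄 ≃L[ℝ] (ι → ℝ))
variable {X X' : Type} [Fintype X] [Fintype X'] (D : LineData X X') {g : B6.Geometry} (blk : X → g.Site)
variable {F₁ F₃ : Type} [AddCommGroup F₁] [Module ℝ F₁] [AddCommGroup F₃] [Module ℝ F₃] {b₁ : BlockNorm g F₁} {b₃ : BlockNorm g F₃}

/-- **ONE DIRECTION OF THE PRINT's `V′₁(A)` (3.52) IN COORDINATES, COEFFICIENT LETTERS DISCHARGED.**  Backgrounds: fine bond field `A′ : X′ → 𝔄`, coarse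
`Ā : X → 𝔄`, `‖A′‖, ‖Ā‖ ≤ r`, blockwise fit `‖A′(x′) − Ā(πx′)‖ ≤ o(blk(πx′))`, bond letter `‖A′(x′) − A′(s′⁻¹x′)‖ ≤ η′G`; divergence fields `V′`, `V̄` with
blockwise fit `o₂`; regime `η₀(2r) ≤ 1`, `0 < η′ ≤ η ≤ η₀`, `Mη′ = η`.  Operators on the product carriers: `V′ = M_{coordMat(ad A′)}∘∇′_{η′} +
M_{coordMat(ad V′)} + M_{coordMat(F′_{1,k}(η′, ad A′))}∘pull s′` and its coarse twin.  CONCLUSION: `T′ ∘ 𝔇(V′, V) ∘ A ≤ (K₁ + K₂ + K₃)·e^{−ρd(y,y′)}·w(y′)`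
with the constants of part 17 at `m₃ = κ_e2r·m₃⁰ + κ_e2G·m_T·m_sh`, `α₃ = κ_e·e(2r)(2r)`.  REMAINING BINDERS (census): geometry (2.54), `hd`, `hdiag`; weight
`w ≥ 0` slow `(σ, C)`; `T′ ≤ N_T` (`m_T`) and its OWN adjoint-derivative entry `T′∘∇′* ≤ N₃⁰` (`m₃⁰`, (3.42)₃); the product shift kernel's row norm `m_sh`;
`A ≤ A₀e^{−(ρ+σ)d}`, `∇_η∘A ≤ A₁e^{−(ρ+σ)d}`, `pull s∘A ≤ A_se^{−(ρ+σ)d}`; the dominations of the DERIVED fits by the weight (`κ_e·2·o ≤ ε₁w`, `κ_e·2·o₂ ≤ ε₂w`,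
`κ_e(2e(2r)o + 2e(2r)³η) ≤ ε₃w`) and of the rate factors (`|η′|(M−1) ≤ c′_ηw`, `|η| ≤ c_ηw`). [folklore] -/
theorem hasMaj_comp_idef_V1dir_comp_coords {η η' η₀ r G : ℝ} (hη'pos : 0 < η') (hη'η : η' ≤ η) (hηη₀ : η ≤ η₀) (hMη : (D.M : ℝ) * η' = η)
    (hreg : η₀ * (2 * r) ≤ 1) (hr : 0 ≤ r) (hG : 0 ≤ G) (htri : Triangle254 g) (hd : ∀ a b : g.Site, 0 ≤ g.dist a b)
    (hdiag : ∀ y, g.dist y y = 0) {ρ σ C ε₁ ε₂ ε₃ A₀ A₁ As m_T m₃ msh cη cη' : ℝ} (hρ : 0 ≤ ρ) (hσ : 0 ≤ σ) (hA₀ : 0 ≤ A₀)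
    (hA₁ : 0 ≤ A₁) (hAs : 0 ≤ As) (hC : 0 ≤ C) (hε₁ : 0 ≤ ε₁) (hε₂ : 0 ≤ ε₂) (hε₃ : 0 ≤ ε₃) (hmsh : 0 ≤ msh)
    {w o o₂ : g.Site → ℝ} (hw : ∀ y, 0 ≤ w y) (hsw : SlowWeight g σ C w)
    (hηw' : ∀ y', |η'| * ((D.M : ℝ) - 1) ≤ cη' * w y') (hηw : ∀ y', |η| ≤ cη * w y') (ho : ∀ y, 0 ≤ o y) (ho₂ : ∀ y, 0 ≤ o₂ y)
    (how₁ : ∀ y, basisConst e * (2 * o y) ≤ ε₁ * w y) (how₂ : ∀ y, basisConst e * (2 * o₂ y) ≤ ε₂ * w y)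
    (how₃ : ∀ y, basisConst e * ((2 * (Real.exp 1 * (2 * r))) * o y + 2 * (Real.exp 1 * (2 * r) ^ 3) * η) ≤ ε₃ * w y)
    {a' v' : X' → 𝔄} {a v : X → 𝔄} (ha' : ∀ x', ‖a' x'‖ ≤ r) (ha : ∀ x, ‖a x‖ ≤ r)
    (hfit : ∀ x', ‖a' x' - a (D.π x')‖ ≤ o (blk (D.π x'))) (hda' : ∀ x', ‖a' x' - a' (D.s'.symm x')‖ ≤ η' * G)
    (hfit₂ : ∀ x', ‖v' x' - v (D.π x')‖ ≤ o₂ (blk (D.π x')))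
    {T' : (X' × ι → ℝ) →ₗ[ℝ] F₃} {A : F₁ →ₗ[ℝ] (X × ι → ℝ)} {N_T N₃ : g.Site → g.Site → ℝ}
    (hNT : ∀ a b, 0 ≤ N_T a b) (hmT : WRow g ρ N_T m_T) (hT : HasMaj (BlockNorm.ofBlocks g (liftBlk (blk ∘ D.π) ι)) b₃ T' N_T)
    (hN₃ : ∀ a b, 0 ≤ N₃ a b) (hm₃ : WRow g ρ N₃ m₃)
    (hS₀ : HasMaj (BlockNorm.ofBlocks g (liftBlk (blk ∘ D.π) ι)) b₃ (T' ∘ₗ bdiffN η' (prodLine D ι).s') N₃)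
    (hsh : WRow g ρ (shiftKernel (prodLine D ι) (liftBlk blk ι)) msh)
    (hA : HasMaj b₁ (BlockNorm.ofBlocks g (liftBlk blk ι)) A (fun y y' => A₀ * Real.exp (-((ρ + σ) * g.dist y y'))))
    (hdA : HasMaj b₁ (BlockNorm.ofBlocks g (liftBlk blk ι)) (fdiffN η (prodLine D ι).s ∘ₗ A)
      (fun y y' => A₁ * Real.exp (-((ρ + σ) * g.dist y y'))))
    (hsA : HasMaj b₁ (BlockNorm.ofBlocks g (liftBlk blk ι)) (pull (prodLine D ι).s ∘ₗ A)
      (fun y y' => As * Real.exp (-((ρ + σ) * g.dist y y')))) :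
    HasMaj b₁ b₃ (T' ∘ₗ idef (pull (prodLine D ι).π) (pull (prodLine D ι).π)
        (mmulOp (fun x' => coordMat e (adCLM ℝ (a' x'))) ∘ₗ fdiffN η' (prodLine D ι).s' +
          mmulOp (fun x' => coordMat e (adCLM ℝ (v' x'))) +
          mmulOp (fun x' => coordMat e (Phi2 η' (adCLM ℝ (a' x')))) ∘ₗ pull (prodLine D ι).s')
        (mmulOp (fun x => coordMat e (adCLM ℝ (a x))) ∘ₗ fdiffN η (prodLine D ι).s +
          mmulOp (fun x => coordMat e (adCLM ℝ (v x))) +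
          mmulOp (fun x => coordMat e (Phi2 η (adCLM ℝ (a x)))) ∘ₗ pull (prodLine D ι).s) ∘ₗ A)
      (fun y y' =>
        (((basisConst e * (2 * r)) * m₃ + (basisConst e * (2 * G)) * (m_T * msh)) * A₁ * cη' + m_T * (ε₁ * A₁ * C) +
          m_T * (ε₂ * A₀ * C) +
          ((basisConst e * (Real.exp 1 * (2 * r) * (2 * r))) * m_T * A₁ * cη + m_T * (ε₃ * As * C))) *
        Real.exp (-(ρ * g.dist y y')) * w y') := by
  have hκ := basisConst_nonneg e
  have hη'0 : 0 ≤ η' := hη'pos.le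
  have hη0 : 0 ≤ η := hη'0.trans hη'η
  -- the composite (3.42)₃ entry of `T′∘M_{ad A′}` in coordinates and its row norm
  have hS := hasMaj_adCoeff_bdiffN_coords e D blk (b₃ := b₃) hη'pos hr hG ha' hda' hN₃ hNT hS₀ hT
  have hm₃' := wrow_adCoeff_bdiffN_coords D ι blk htri hρ hκ hr hG hmsh hNT hm₃ hmT hsh
  have hN₃' : ∀ y y', 0 ≤ (basisConst e * (2 * r)) * N₃ y y' +
      (basisConst e * (2 * G)) * ∑ y'', N_T y y'' * shiftKernel (prodLine D ι) (liftBlk blk ι) y'' y' := fun y y' =>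
    add_nonneg (mul_nonneg (by positivity) (hN₃ y y'))
      (mul_nonneg (by positivity) (Finset.sum_nonneg fun y'' _ => mul_nonneg (hNT y y'') (shiftKernel_nonneg _ _ _ _)))
  -- the derived coefficient letters (part 17 §3)
  have ho₁' : ∀ y, 0 ≤ basisConst e * (2 * o y) := fun y => by have := ho y; positivity
  have ho₂' : ∀ y, 0 ≤ basisConst e * (2 * o₂ y) := fun y => by have := ho₂ y; positivity
  have ho₃' : ∀ y, 0 ≤ basisConst e * ((2 * (Real.exp 1 * (2 * r))) * o y + 2 * (Real.exp 1 * (2 * r) ^ 3) * η) := fun y => by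
    have := ho y; positivity
  have key := hasMaj_comp_idef_V1dir_comp D ι blk (b₁ := b₁) (b₃ := b₃)
    (C₁' := fun x' => coordMat e (adCLM ℝ (a' x'))) (C₁ := fun x => coordMat e (adCLM ℝ (a x)))
    (C₂' := fun x' => coordMat e (adCLM ℝ (v' x'))) (C₂ := fun x => coordMat e (adCLM ℝ (v x)))
    (C₃' := fun x' => coordMat e (Phi2 η' (adCLM ℝ (a' x')))) (C₃ := fun x => coordMat e (Phi2 η (adCLM ℝ (a x))))
    (o₁ := fun y => basisConst e * (2 * o y)) (o₂ := fun y => basisConst e * (2 * o₂ y))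
    (o₃ := fun y => basisConst e * ((2 * (Real.exp 1 * (2 * r))) * o y + 2 * (Real.exp 1 * (2 * r) ^ 3) * η))
    (hη'pos.trans_le hη'η).ne' hη'pos.ne' hMη htri hd hdiag hρ hσ
    hA₀ hA₁ hAs hC hε₁ hε₂ hε₃ (mul_nonneg hκ (by positivity)) hw hsw hηw' hηw ho₁' how₁ ho₂' how₂ ho₃' how₃
    (rowFit_ad e D.π (o := fun x => o (blk x)) hfit) (rowFit_ad e D.π (o := fun x => o₂ (blk x)) hfit₂)
    (rowFit_Phi2_ad e D.π hreg hr hη'0 hη'η hηη₀ ha' ha (o := fun x => o (blk x)) hfit)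
    (rowBound_Phi2_ad e hreg hr hη'0 (hη'η.trans hηη₀) ha') hNT hmT hT hN₃' hm₃' hS hA hdA hsA
  refine key.mono fun y y' => le_of_eq ?_
  ring

end V1Coords

end Summit.QuantumFields.YangMills.BalabanUVNodes.N15.MatrixSpecies
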